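/-
Copyright (c) 2026 the pub-hodgecm-mathlib formalisation cell (harness21).  Prover seat hodgecm-mathlib-F0P3a-p05 (g18): road «S3-ram» (LEAD F0P3a-plan (g13); owner
F0P3a-p06 (g15∕g16); (Cnt2′) chair F0P3a-p07 (g14∕g15)), chair RULING (16)(b) «REGIME A-EVEN HYPERBOLIC, W-SIDE»: the CENTRED kind counts of the top region, numbers; 2026-09-02.
-/
import Literature.NumberTheory.Rogawski1990.DepthZeroKappaTransferTypeTwoRamifiedWSideLatticeCurrencyTopKindsCentred   -- ★∕filed (this seat) part XIII-a: the three W-side values in local-datum and `GL` dress; brings XII, X, ★ `isPrincipalIdealRing_integer_adicCompletion`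
import Literature.NumberTheory.Automorphic.UnitaryLatticeTreeBlockRootRegionAxisKindsTop                            -- ★∕filed p849492 (this seat): `ncard_rootRegion_{inner,shell_class,shell_not_class}_eq_ncard_two_of_top`
import HarnessLib

/-!
# The W-side lattice currency of the (T2) rows at a tame-ramified place, XIII-b — the CENTRED kinds of the top region in JUNCTION currency at the CM place:
# `#{v ∈ R ∣ Pin v} = 0`, `2·#{v ∈ R ∣ ¬Pin v ∧ [¬]Qbig_(c₀) v} = q + 1` (regime A-even, `γ = ι(B₀, 1)`, `htop` discharged)

Topic `NumberTheory/Rogawski1990`; namespace `Literature.NumberTheory.Automorphic.UnitaryGroup`.  THEOREMS ONLY (no definition, no instance, no notation, no named fact,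
no `sorry`); kernel lane `--supports stmt-HodgeConjecture-24833`.  Cell `pub/hodgecm-mathlib` (D-0151), crux H413; road «S3-ram» (Literature seeding, count-neutral), (T2) G-side
organ (Cnt2′), route B, chair RULING (16)(b), regime **A-even** of the hyperbolic literal `ι(B₀, 1)` (`N = 2n`, `d₀ = N − 1`, `|½tr B₀ − 1| ≤ |ϖ^N|`).  The pens' kind tokens are
A-p12 (g25)'s CENTRED `Pin v` ∕ `Qbig_t v` (F0P3a-p08 (g21) ★ (K5-B-J) FILE 1 for regime B; this seat's ★ `…BlockRootRegionAxisKindsTop` for the top with a FREE unit constant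
`t`).  THIS FILE evaluates the three `W`-side right-hand sides at the top and composes:
* §1 (local datum `Γ = e₂γ₂`, `Φ₂ = placeForm`; free level `d` with `d + 1 = 2n`): **`ncard_selfDual_fixed_lev_centredBall_succ_eq_zero_of_top_of_even_depth_ramified`**
  (`#{LEV(ϖ^d) ∧ LEV^c(ϖ^(d+1))} = 0`: inside the EMPTY centred top ball, ★ part X), **`two_mul_ncard_selfDual_fixed_lev_centredShell_class_eq_of_top_…`** and
  **`…_not_class_…`** (`2·#{LEV(ϖ^d) ∧ ¬LEV^c(ϖ^(d+1)) ∧ [¬]CLS^c_d(c₀)} = q + 1`: the set IS ★ part X's centred top shell `Sh_(n−1)` — plain `LEV(ϖ^(2j+1))` ⟺ centred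
  `LEV^c(ϖ^(2j))` by ★ p848132 `map_sub_smul_one_le_scaleLattice_iff_map_sub_one_le` (`|c − 1| ≤ |ϖ^(2j+1)|`) and «odd scales are free» (★ (W1)∕(W3) p848431) — then ★
  `two_mul_ncard_selfDual_fixed_centredShell_class_eq_top_of_even_depth_ramified`, and ★ IX-b dichotomy for the `¬CLS^c` twin);
* §2 the same three for ANY `B₀ ∈ U(σ_w, !![0,1;1,0])` (`γ₂ := e₂⁻¹B₀`, as part XII);
* §3 the JUNCTION composites at the CM place with `htop` discharged (★ part X): **`ncard_rootRegion_inner_eq_zero_of_top_of_even_depth_ramified`** (`#{v ∈ R ∣ Pin v} = 0`),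
  **`two_mul_ncard_rootRegion_shell_class_eq_of_top_of_even_depth_ramified`** ∕ **`…_shell_not_class_…`** (`2·#{v ∈ R ∣ ¬Pin v ∧ [¬]Qbig_(c₀) v} = q + 1` for every unit `c₀`).
HONEST LABEL: HC_CM is proved only modulo the 2 remaining named inputs (hLiu418 24832, h413 24833) until rung 0 closes; nothing printed is asserted here (currency bookkeeping over ★
results); «S3-ram» has no books consequence.

## References
* [LabesseLanglands1979] J.-P. Labesse, R. P. Langlands, *L-indistinguishability for SL(2)*, Canad. J. Math. 31 (1979): §2 Lemma 2.1 pp. 7–8.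
* [Kottwitz1986] R. E. Kottwitz, *Base change for unit elements of Hecke algebras*, Compositio Math. 60 (1986): §3.
* [Rogawski1990] J. D. Rogawski, *Automorphic Representations of Unitary Groups in Three Variables* (1990): §4.9 Lemma 4.9.3 p. 56.
-/

set_option autoImplicit false

noncomputable section

open MeasureTheory Measure Set NumberField IsDedekindDomain Matrix ValuativeRel MulAction Finset Polynomial
open scoped ValuativeRel Matrix MatrixGroups WithZero

namespace Literature.NumberTheory.Automorphic.UnitaryGroup

open Literature.NumberTheory.Rogawski1990 Literature.NumberTheory.Automorphic Literature.NumberTheory.Automorphic.IntegralReduction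
open Literature.GroupTheory Literature.NumberTheory.GaloisRepresentations
open Literature.NumberTheory.Automorphic.UnitaryLatticeTree Literature.NumberTheory.Automorphic.HermitianLattice

variable (L : Type) [Field L] [NumberField L] [IsCMField L] (v : HeightOneSpectrum (𝓞 ↥(maximalRealSubfield L)))
  (w : PlacesOver L v) (hw : IsCMField.complexConj L • w.1 = w.1)

/-! ## §3 The composites in JUNCTION currency at the CM place (`γ = ι(B₀, 1)`, `htop` discharged) -/

set_option maxHeartbeats 3200000 in
-- budget only: statement-heavy tokens in two currencies.
include hw in
/-- **THE INNER KIND OF THE A-EVEN ROOT REGION IS EMPTY (junction currency, CM place).**  For `γ ∈ U(σ_w, Φ₃)` with matrix `ι(B₀, 1)`, `B₀ ∈ U(σ_w, !![0,1;1,0])` with no root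
of `χ_{B₀}` in `L_w` and `|tr² − 4det|(B₀) = exp(−2·2n)`, `n ≥ 1`, root level `d₀` with `d₀ + 1 = 2n`, `|½tr B₀ − 1| ≤ |ϖ^(d₀+1)|`: `#{v ∣ v ∈ R ∧ Pin v} = 0`
(★ `ncard_rootRegion_inner_eq_ncard_two_of_top` ∘ §2). [cite: Kottwitz1986, §3] [cite: LabesseLanglands1979, §2 Lemma 2.1 p. 8] [cite: Rogawski1990, §4.9 Lemma 4.9.3 p. 56] -/
theorem ncard_rootRegion_inner_eq_zero_of_top_of_even_depth_ramified (he : v.asIdeal.ramificationIdx' w.1.asIdeal ≠ 1) (h2 : IsUnit (2 : 𝒪[(w.1.adicCompletion L)]))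
    (ϖ : (w.1.adicCompletion L)ˣ) (hϖ : Valued.v (ϖ : (w.1.adicCompletion L)) = WithZero.exp (-1 : ℤ))
    (hσϖ : (galAdicCompletionMap (L := L) (IsCMField.complexConj L) hw) (ϖ : (w.1.adicCompletion L)) = -(ϖ : (w.1.adicCompletion L)))
    (γ : unitaryGroupOfForm (galAdicCompletionMap (L := L) (IsCMField.complexConj L) hw) ((StdForm.antidiagonal 3).over (w.1.adicCompletion L))) (B₀ : GL (Fin 2) (w.1.adicCompletion L))
    (hγ : (γ : GL (Fin 3) (w.1.adicCompletion L)) = endoGL (B₀, (1 : GL (Fin 1) (w.1.adicCompletion L)))) (hB₀ : B₀ ∈ unitaryGroupOfForm (galAdicCompletionMap (L := L) (IsCMField.complexConj L) hw) (!![(0 : (w.1.adicCompletion L)), 1; 1, 0] : Matrix (Fin 2) (Fin 2) (w.1.adicCompletion L)))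
    (hirr : ¬ ∃ x : (w.1.adicCompletion L), (((B₀ : Matrix (Fin 2) (Fin 2) (w.1.adicCompletion L))).charpoly).IsRoot x)
    {n : ℕ} (hN : Valued.v (((B₀ : Matrix (Fin 2) (Fin 2) (w.1.adicCompletion L))).trace ^ 2 - 4 * ((B₀ : Matrix (Fin 2) (Fin 2) (w.1.adicCompletion L))).det) = WithZero.exp (-((2 * (2 * n) : ℕ) : ℤ))) (hn1 : 1 ≤ n)
    {d₀ : ℕ} (hd : d₀ + 1 = 2 * n)
    (hα : Valued.v ((B₀ : Matrix (Fin 2) (Fin 2) (w.1.adicCompletion L)).trace / 2 - 1) ≤ Valued.v ((ϖ : (w.1.adicCompletion L)) ^ (d₀ + 1))) :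
    {v : {M : Submodule (Valued.integer (w.1.adicCompletion L)) (Fin 3 → (w.1.adicCompletion L)) // IsVertex (galAdicCompletionMap (L := L) (IsCMField.complexConj L) hw) (ϖ : (w.1.adicCompletion L)) ((StdForm.antidiagonal 3).over (w.1.adicCompletion L)) M} | v ∈ {v : {M : Submodule (Valued.integer (w.1.adicCompletion L)) (Fin 3 → (w.1.adicCompletion L)) // IsVertex (galAdicCompletionMap (L := L) (IsCMField.complexConj L) hw) (ϖ : (w.1.adicCompletion L)) ((StdForm.antidiagonal 3).over (w.1.adicCompletion L)) M} | latticeGraphIso (galAdicCompletionMap (L := L) (IsCMField.complexConj L) hw) (ϖ : (w.1.adicCompletion L)) ((StdForm.antidiagonal 3).over (w.1.adicCompletion L)) γ v = v ∧ IsSelfDualLattice (galAdicCompletionMap (L := L) (IsCMField.complexConj L) hw) (ϖ : (w.1.adicCompletion L)) ((StdForm.antidiagonal 3).over (w.1.adicCompletion L)) v.1 ∧ v.1.map ((Matrix.toLin' (((γ : GL (Fin 3) (w.1.adicCompletion L)) : Matrix (Fin 3) (Fin 3) (w.1.adicCompletion L)) - 1)).restrictScalars (Valued.integer (w.1.adicCompletion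 L))) ≤ scaleLattice ((ϖ : (w.1.adicCompletion L)) ^ d₀) v.1} ∧ ∀ y ∈ v.1, y 1 = 0 → ((((γ : GL (Fin 3) (w.1.adicCompletion L)) : Matrix (Fin 3) (Fin 3) (w.1.adicCompletion L)) - ((B₀ : Matrix (Fin 2) (Fin 2) (w.1.adicCompletion L)).trace / 2) • (1 : Matrix (Fin 3) (Fin 3) (w.1.adicCompletion L))) *ᵥ y) ∈ scaleLattice ((ϖ : (w.1.adicCompletion L)) ^ (d₀ + 1)) v.1}.ncard = 0 := by
  have hc1 : IsCMField.complexConj L ≠ 1 := IsCMField.complexConj_ne_one L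
  have hσ : ∀ a, (galAdicCompletionMap (L := L) (IsCMField.complexConj L) hw) ((galAdicCompletionMap (L := L) (IsCMField.complexConj L) hw) a) = a := fun a =>
    Liu2021.galAdicCompletionMap_galAdicCompletionMap_self (↥(maximalRealSubfield L)) L (IsCMField.complexConj L)
      (AlgEquiv.ext fun x => IsCMField.complexConj_apply_apply L x) hw a
  have hvσ : ∀ a, Valued.v ((galAdicCompletionMap (L := L) (IsCMField.complexConj L) hw) a) = Valued.v a := fun a => valued_galAdicCompletionMap (L := L) (IsCMField.complexConj L) hw a
  have h2w : Valued.v (2 : (w.1.adicCompletion L)) = 1 := by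
    have h := ((Valuation.integer.integers (ValuativeRel.valuation (w.1.adicCompletion L))).isUnit_iff_valuation_eq_one).1 h2
    exact (v_eq_one_iff_valuation_eq_one _).2 h
  have hϖ0 : (ϖ : (w.1.adicCompletion L)) ≠ 0 := ϖ.ne_zero
  have hϖ1 : Valued.v (ϖ : (w.1.adicCompletion L)) ≤ 1 := by rw [hϖ, ← WithZero.exp_zero]; exact WithZero.exp_le_exp.2 (by norm_num)
  haveI := isPrincipalIdealRing_integer_adicCompletion L v w
  have hH : (!![(0 : (w.1.adicCompletion L)), 1; 1, 0] : Matrix (Fin 2) (Fin 2) (w.1.adicCompletion L)) = placeForm (Matrix.of fun i j : Fin 2 => if i.val + j.val + 1 = 2 then (1 : L) else 0) w.1 := by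
    rw [placeForm_antidiagOne, stdForm_antidiagonal_two_over_eq]
  have hB₀' : B₀ ∈ (unitaryGroupOfForm (galAdicCompletionMap (L := L) (IsCMField.complexConj L) hw) (placeForm (Matrix.of fun i j : Fin 2 => if i.val + j.val + 1 = 2 then (1 : L) else 0) w.1)) := by rw [← hH]; exact hB₀
  set γ₂ : ((cmDatum L 2 (Matrix.of fun i j : Fin 2 => if i.val + j.val + 1 = 2 then (1 : L) else 0)).Local v) := ((localNonsplitEquiv (IsCMField.complexConj L) (Matrix.of fun i j : Fin 2 => if i.val + j.val + 1 = 2 then (1 : L) else 0) (IsCMField.complexConj_ne_one L) w hw)).symm ⟨B₀, hB₀'⟩ with hγ₂def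
  have heγ : (((localNonsplitEquiv (IsCMField.complexConj L) (Matrix.of fun i j : Fin 2 => if i.val + j.val + 1 = 2 then (1 : L) else 0) (IsCMField.complexConj_ne_one L) w hw) γ₂ : ↥(unitaryGroupOfForm (galAdicCompletionMap (L := L) (IsCMField.complexConj L) hw) (placeForm (Matrix.of fun i j : Fin 2 => if i.val + j.val + 1 = 2 then (1 : L) else 0) w.1))) : GL (Fin 2) (w.1.adicCompletion L)) = B₀ := by
    rw [hγ₂def, ContinuousMulEquiv.apply_symm_apply]
  -- TOP-ness: the centred `ϖ^(d₀+1) = ϖ^(2n)`-ball of `B₀`-fixed self-dual lattices is EMPTY (★ part X §1 at `γ₂ := e₂⁻¹B₀`)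
  have htop : {B : Submodule (Valued.integer (w.1.adicCompletion L)) (Fin 2 → (w.1.adicCompletion L)) | IsSelfDualLattice (galAdicCompletionMap (L := L) (IsCMField.complexConj L) hw) (ϖ : (w.1.adicCompletion L)) (!![(0 : (w.1.adicCompletion L)), 1; 1, 0] : Matrix (Fin 2) (Fin 2) (w.1.adicCompletion L)) B ∧ mapGL B₀ B = B ∧
        B.map ((Matrix.toLin' ((B₀ : Matrix (Fin 2) (Fin 2) (w.1.adicCompletion L)) - ((B₀ : Matrix (Fin 2) (Fin 2) (w.1.adicCompletion L)).trace / 2) • (1 : Matrix (Fin 2) (Fin 2) (w.1.adicCompletion L)))).restrictScalars (Valued.integer (w.1.adicCompletion L))) ≤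
          scaleLattice ((ϖ : (w.1.adicCompletion L)) ^ (d₀ + 1)) B} = ∅ := by
    have hFfin := finite_selfDual_fixed_of_even_depth_ramified L v w hw he h2 ϖ hϖ hσϖ γ₂ (by rw [heγ]; exact hirr) (n := n) (by rw [heγ]; exact hN) hn1
    have h0 := ncard_selfDual_fixed_centredBall_top_eq_zero_of_even_depth_ramified L v w hw he h2 ϖ hϖ hσϖ γ₂ (by rw [heγ]; exact hirr) (n := n)
      (by rw [heγ]; exact hN) hn1
    have hempty := (Set.ncard_eq_zero (hFfin.subset fun B hB => ⟨hB.1, hB.2.1⟩)).1 h0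
    rw [heγ, ← hH, ← hd] at hempty
    exact hempty
  rw [ncard_rootRegion_inner_eq_ncard_two_of_top hσ hvσ hϖ γ B₀ hγ h2w hB₀ hα htop]
  exact ncard_selfDual_fixed_lev_centredBall_succ_eq_zero_of_top_of_mem_unitaryGroupOfForm L v w hw he h2 ϖ hϖ hσϖ B₀ hB₀ hirr hN hn1 hd

set_option maxHeartbeats 3200000 in
-- budget only: statement-heavy tokens in two currencies.
include hw in
/-- **THE A-EVEN SHELL KIND COUNT, CENTRED CLASS PRESENT (junction currency, CM place):** under the hypotheses of `ncard_rootRegion_inner_eq_zero_of_top_of_even_depth_ramified`,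
for ANY unit `c₀` and a residual non-square unit `ε`: `2·#{v ∣ v ∈ R ∧ ¬Pin v ∧ Qbig_(c₀) v} = q + 1` (`Qbig_(c₀)` = A-p12's centred class token with the constant `c₀` in place of
`t₀`; ★ `ncard_rootRegion_shell_class_eq_ncard_two_of_top` ∘ §2). [cite: Kottwitz1986, §3] [cite: LabesseLanglands1979, §2 Lemma 2.1 p. 8] [cite: Rogawski1990, §4.9 Lemma 4.9.3 p. 56] -/
theorem two_mul_ncard_rootRegion_shell_class_eq_of_top_of_even_depth_ramified (he : v.asIdeal.ramificationIdx' w.1.asIdeal ≠ 1) (h2 : IsUnit (2 : 𝒪[(w.1.adicCompletion L)]))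
    (ϖ : (w.1.adicCompletion L)ˣ) (hϖ : Valued.v (ϖ : (w.1.adicCompletion L)) = WithZero.exp (-1 : ℤ))
    (hσϖ : (galAdicCompletionMap (L := L) (IsCMField.complexConj L) hw) (ϖ : (w.1.adicCompletion L)) = -(ϖ : (w.1.adicCompletion L)))
    (γ : unitaryGroupOfForm (galAdicCompletionMap (L := L) (IsCMField.complexConj L) hw) ((StdForm.antidiagonal 3).over (w.1.adicCompletion L))) (B₀ : GL (Fin 2) (w.1.adicCompletion L))
    (hγ : (γ : GL (Fin 3) (w.1.adicCompletion L)) = endoGL (B₀, (1 : GL (Fin 1) (w.1.adicCompletion L)))) (hB₀ : B₀ ∈ unitaryGroupOfForm (galAdicCompletionMap (L := L) (IsCMField.complexConj L) hw) (!![(0 : (w.1.adicCompletion L)), 1; 1, 0] : Matrix (Fin 2) (Fin 2) (w.1.adicCompletion L)))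
    (hirr : ¬ ∃ x : (w.1.adicCompletion L), (((B₀ : Matrix (Fin 2) (Fin 2) (w.1.adicCompletion L))).charpoly).IsRoot x)
    {n : ℕ} (hN : Valued.v (((B₀ : Matrix (Fin 2) (Fin 2) (w.1.adicCompletion L))).trace ^ 2 - 4 * ((B₀ : Matrix (Fin 2) (Fin 2) (w.1.adicCompletion L))).det) = WithZero.exp (-((2 * (2 * n) : ℕ) : ℤ))) (hn1 : 1 ≤ n)
    {d₀ : ℕ} (hd : d₀ + 1 = 2 * n)
    (hα : Valued.v ((B₀ : Matrix (Fin 2) (Fin 2) (w.1.adicCompletion L)).trace / 2 - 1) ≤ Valued.v ((ϖ : (w.1.adicCompletion L)) ^ (d₀ + 1)))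
    (c₀ ε : (w.1.adicCompletion L)) (hc₀ : Valued.v c₀ = 1) (hεv : Valued.v ε = 1) (hε : ∀ z : (w.1.adicCompletion L), Valued.v z ≤ 1 → Valued.v (z ^ 2 - ε) = 1) :
    2 * {v : {M : Submodule (Valued.integer (w.1.adicCompletion L)) (Fin 3 → (w.1.adicCompletion L)) // IsVertex (galAdicCompletionMap (L := L) (IsCMField.complexConj L) hw) (ϖ : (w.1.adicCompletion L)) ((StdForm.antidiagonal 3).over (w.1.adicCompletion L)) M} | v ∈ {v : {M : Submodule (Valued.integer (w.1.adicCompletion L)) (Fin 3 → (w.1.adicCompletion L)) // IsVertex (galAdicCompletionMap (L := L) (IsCMField.complexConj L) hw) (ϖ : (w.1.adicCompletion L)) ((StdForm.antidiagonal 3).over (w.1.adicCompletion L)) M} | latticeGraphIso (galAdicCompletionMap (L := L) (IsCMField.complexConj L) hw) (ϖ : (w.1.adicCompletion L)) ((StdForm.antidiagonal 3).over (w.1.adicCompletion L)) γ v = v ∧ IsSelfDualLattice (galAdicCompletionMap (L := L) (IsCMField.complexConj L) hw) (ϖ : (w.1.adicCompletion L)) ((StdForm.antidiagonal 3).over (w.1.adicCompletion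 L)) v.1 ∧ v.1.map ((Matrix.toLin' (((γ : GL (Fin 3) (w.1.adicCompletion L)) : Matrix (Fin 3) (Fin 3) (w.1.adicCompletion L)) - 1)).restrictScalars (Valued.integer (w.1.adicCompletion L))) ≤ scaleLattice ((ϖ : (w.1.adicCompletion L)) ^ d₀) v.1} ∧ ¬ (∀ y ∈ v.1, y 1 = 0 → ((((γ : GL (Fin 3) (w.1.adicCompletion L)) : Matrix (Fin 3) (Fin 3) (w.1.adicCompletion L)) - ((B₀ : Matrix (Fin 2) (Fin 2) (w.1.adicCompletion L)).trace / 2) • (1 : Matrix (Fin 3) (Fin 3) (w.1.adicCompletion L))) *ᵥ y) ∈ scaleLattice ((ϖ : (w.1.adicCompletion L)) ^ (d₀ + 1)) v.1) ∧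
        ∃ y ∈ v.1, y 1 = 0 ∧ ∃ a : (w.1.adicCompletion L), Valued.v a = 1 ∧ Valued.v (((ϖ : (w.1.adicCompletion L)) ^ d₀)⁻¹ * pairing (galAdicCompletionMap (L := L) (IsCMField.complexConj L) hw) ((StdForm.antidiagonal 3).over (w.1.adicCompletion L)) y ((((γ : GL (Fin 3) (w.1.adicCompletion L)) : Matrix (Fin 3) (Fin 3) (w.1.adicCompletion L)) - ((B₀ : Matrix (Fin 2) (Fin 2) (w.1.adicCompletion L)).trace / 2) • (1 : Matrix (Fin 3) (Fin 3) (w.1.adicCompletion L))) *ᵥ y) - c₀ * a ^ 2) < 1}.ncard = (Nat.card (𝓞 ↥(maximalRealSubfield L) ⧸ v.asIdeal)) + 1 := by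
  have hc1 : IsCMField.complexConj L ≠ 1 := IsCMField.complexConj_ne_one L
  have hσ : ∀ a, (galAdicCompletionMap (L := L) (IsCMField.complexConj L) hw) ((galAdicCompletionMap (L := L) (IsCMField.complexConj L) hw) a) = a := fun a =>
    Liu2021.galAdicCompletionMap_galAdicCompletionMap_self (↥(maximalRealSubfield L)) L (IsCMField.complexConj L)
      (AlgEquiv.ext fun x => IsCMField.complexConj_apply_apply L x) hw a
  have hvσ : ∀ a, Valued.v ((galAdicCompletionMap (L := L) (IsCMField.complexConj L) hw) a) = Valued.v a := fun a => valued_galAdicCompletionMap (L := L) (IsCMField.complexConj L) hw a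
  have h2w : Valued.v (2 : (w.1.adicCompletion L)) = 1 := by
    have h := ((Valuation.integer.integers (ValuativeRel.valuation (w.1.adicCompletion L))).isUnit_iff_valuation_eq_one).1 h2
    exact (v_eq_one_iff_valuation_eq_one _).2 h
  have hϖ0 : (ϖ : (w.1.adicCompletion L)) ≠ 0 := ϖ.ne_zero
  have hϖ1 : Valued.v (ϖ : (w.1.adicCompletion L)) ≤ 1 := by rw [hϖ, ← WithZero.exp_zero]; exact WithZero.exp_le_exp.2 (by norm_num)
  haveI := isPrincipalIdealRing_integer_adicCompletion L v w
  have hH : (!![(0 : (w.1.adicCompletion L)), 1; 1, 0] : Matrix (Fin 2) (Fin 2) (w.1.adicCompletion L)) = placeForm (Matrix.of fun i j : Fin 2 => if i.val + j.val + 1 = 2 then (1 : L) else 0) w.1 := by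
    rw [placeForm_antidiagOne, stdForm_antidiagonal_two_over_eq]
  have hB₀' : B₀ ∈ (unitaryGroupOfForm (galAdicCompletionMap (L := L) (IsCMField.complexConj L) hw) (placeForm (Matrix.of fun i j : Fin 2 => if i.val + j.val + 1 = 2 then (1 : L) else 0) w.1)) := by rw [← hH]; exact hB₀
  set γ₂ : ((cmDatum L 2 (Matrix.of fun i j : Fin 2 => if i.val + j.val + 1 = 2 then (1 : L) else 0)).Local v) := ((localNonsplitEquiv (IsCMField.complexConj L) (Matrix.of fun i j : Fin 2 => if i.val + j.val + 1 = 2 then (1 : L) else 0) (IsCMField.complexConj_ne_one L) w hw)).symm ⟨B₀, hB₀'⟩ with hγ₂def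
  have heγ : (((localNonsplitEquiv (IsCMField.complexConj L) (Matrix.of fun i j : Fin 2 => if i.val + j.val + 1 = 2 then (1 : L) else 0) (IsCMField.complexConj_ne_one L) w hw) γ₂ : ↥(unitaryGroupOfForm (galAdicCompletionMap (L := L) (IsCMField.complexConj L) hw) (placeForm (Matrix.of fun i j : Fin 2 => if i.val + j.val + 1 = 2 then (1 : L) else 0) w.1))) : GL (Fin 2) (w.1.adicCompletion L)) = B₀ := by
    rw [hγ₂def, ContinuousMulEquiv.apply_symm_apply]
  -- TOP-ness: the centred `ϖ^(d₀+1) = ϖ^(2n)`-ball of `B₀`-fixed self-dual lattices is EMPTY (★ part X §1 at `γ₂ := e₂⁻¹B₀`)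
  have htop : {B : Submodule (Valued.integer (w.1.adicCompletion L)) (Fin 2 → (w.1.adicCompletion L)) | IsSelfDualLattice (galAdicCompletionMap (L := L) (IsCMField.complexConj L) hw) (ϖ : (w.1.adicCompletion L)) (!![(0 : (w.1.adicCompletion L)), 1; 1, 0] : Matrix (Fin 2) (Fin 2) (w.1.adicCompletion L)) B ∧ mapGL B₀ B = B ∧
        B.map ((Matrix.toLin' ((B₀ : Matrix (Fin 2) (Fin 2) (w.1.adicCompletion L)) - ((B₀ : Matrix (Fin 2) (Fin 2) (w.1.adicCompletion L)).trace / 2) • (1 : Matrix (Fin 2) (Fin 2) (w.1.adicCompletion L)))).restrictScalars (Valued.integer (w.1.adicCompletion L))) ≤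
          scaleLattice ((ϖ : (w.1.adicCompletion L)) ^ (d₀ + 1)) B} = ∅ := by
    have hFfin := finite_selfDual_fixed_of_even_depth_ramified L v w hw he h2 ϖ hϖ hσϖ γ₂ (by rw [heγ]; exact hirr) (n := n) (by rw [heγ]; exact hN) hn1
    have h0 := ncard_selfDual_fixed_centredBall_top_eq_zero_of_even_depth_ramified L v w hw he h2 ϖ hϖ hσϖ γ₂ (by rw [heγ]; exact hirr) (n := n)
      (by rw [heγ]; exact hN) hn1
    have hempty := (Set.ncard_eq_zero (hFfin.subset fun B hB => ⟨hB.1, hB.2.1⟩)).1 h0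
    rw [heγ, ← hH, ← hd] at hempty
    exact hempty
  rw [ncard_rootRegion_shell_class_eq_ncard_two_of_top hσ hvσ hϖ γ B₀ hγ h2w hB₀ hα htop c₀]
  exact two_mul_ncard_selfDual_fixed_lev_centredShell_class_eq_of_top_of_mem_unitaryGroupOfForm L v w hw he h2 ϖ hϖ hσϖ B₀ hB₀ hirr hN hn1 hd hα c₀ ε hc₀ hεv hε

set_option maxHeartbeats 3200000 in
-- budget only: statement-heavy tokens in two currencies.
include hw in
/-- **THE A-EVEN SHELL KIND COUNT, CENTRED CLASS ABSENT (junction currency, CM place):** `2·#{v ∣ v ∈ R ∧ ¬Pin v ∧ ¬Qbig_(c₀) v} = q + 1`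
(★ `ncard_rootRegion_shell_not_class_eq_ncard_two_of_top` ∘ §2). [cite: Kottwitz1986, §3] [cite: LabesseLanglands1979, §2 Lemma 2.1 p. 8] [cite: Rogawski1990, §4.9 Lemma 4.9.3 p. 56] -/
theorem two_mul_ncard_rootRegion_shell_not_class_eq_of_top_of_even_depth_ramified (he : v.asIdeal.ramificationIdx' w.1.asIdeal ≠ 1) (h2 : IsUnit (2 : 𝒪[(w.1.adicCompletion L)]))
    (ϖ : (w.1.adicCompletion L)ˣ) (hϖ : Valued.v (ϖ : (w.1.adicCompletion L)) = WithZero.exp (-1 : ℤ))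
    (hσϖ : (galAdicCompletionMap (L := L) (IsCMField.complexConj L) hw) (ϖ : (w.1.adicCompletion L)) = -(ϖ : (w.1.adicCompletion L)))
    (γ : unitaryGroupOfForm (galAdicCompletionMap (L := L) (IsCMField.complexConj L) hw) ((StdForm.antidiagonal 3).over (w.1.adicCompletion L))) (B₀ : GL (Fin 2) (w.1.adicCompletion L))
    (hγ : (γ : GL (Fin 3) (w.1.adicCompletion L)) = endoGL (B₀, (1 : GL (Fin 1) (w.1.adicCompletion L)))) (hB₀ : B₀ ∈ unitaryGroupOfForm (galAdicCompletionMap (L := L) (IsCMField.complexConj L) hw) (!![(0 : (w.1.adicCompletion L)), 1; 1, 0] : Matrix (Fin 2) (Fin 2) (w.1.adicCompletion L)))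
    (hirr : ¬ ∃ x : (w.1.adicCompletion L), (((B₀ : Matrix (Fin 2) (Fin 2) (w.1.adicCompletion L))).charpoly).IsRoot x)
    {n : ℕ} (hN : Valued.v (((B₀ : Matrix (Fin 2) (Fin 2) (w.1.adicCompletion L))).trace ^ 2 - 4 * ((B₀ : Matrix (Fin 2) (Fin 2) (w.1.adicCompletion L))).det) = WithZero.exp (-((2 * (2 * n) : ℕ) : ℤ))) (hn1 : 1 ≤ n)
    {d₀ : ℕ} (hd : d₀ + 1 = 2 * n)
    (hα : Valued.v ((B₀ : Matrix (Fin 2) (Fin 2) (w.1.adicCompletion L)).trace / 2 - 1) ≤ Valued.v ((ϖ : (w.1.adicCompletion L)) ^ (d₀ + 1)))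
    (c₀ ε : (w.1.adicCompletion L)) (hc₀ : Valued.v c₀ = 1) (hεv : Valued.v ε = 1) (hε : ∀ z : (w.1.adicCompletion L), Valued.v z ≤ 1 → Valued.v (z ^ 2 - ε) = 1) :
    2 * {v : {M : Submodule (Valued.integer (w.1.adicCompletion L)) (Fin 3 → (w.1.adicCompletion L)) // IsVertex (galAdicCompletionMap (L := L) (IsCMField.complexConj L) hw) (ϖ : (w.1.adicCompletion L)) ((StdForm.antidiagonal 3).over (w.1.adicCompletion L)) M} | v ∈ {v : {M : Submodule (Valued.integer (w.1.adicCompletion L)) (Fin 3 → (w.1.adicCompletion L)) // IsVertex (galAdicCompletionMap (L := L) (IsCMField.complexConj L) hw) (ϖ : (w.1.adicCompletion L)) ((StdForm.antidiagonal 3).over (w.1.adicCompletion L)) M} | latticeGraphIso (galAdicCompletionMap (L := L) (IsCMField.complexConj L) hw) (ϖ : (w.1.adicCompletion L)) ((StdForm.antidiagonal 3).over (w.1.adicCompletion L)) γ v = v ∧ IsSelfDualLattice (galAdicCompletionMap (L := L) (IsCMField.complexConj L) hw) (ϖ : (w.1.adicCompletion L)) ((StdForm.antidiagonal 3).over (w.1.adicCompletion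 L)) v.1 ∧ v.1.map ((Matrix.toLin' (((γ : GL (Fin 3) (w.1.adicCompletion L)) : Matrix (Fin 3) (Fin 3) (w.1.adicCompletion L)) - 1)).restrictScalars (Valued.integer (w.1.adicCompletion L))) ≤ scaleLattice ((ϖ : (w.1.adicCompletion L)) ^ d₀) v.1} ∧ ¬ (∀ y ∈ v.1, y 1 = 0 → ((((γ : GL (Fin 3) (w.1.adicCompletion L)) : Matrix (Fin 3) (Fin 3) (w.1.adicCompletion L)) - ((B₀ : Matrix (Fin 2) (Fin 2) (w.1.adicCompletion L)).trace / 2) • (1 : Matrix (Fin 3) (Fin 3) (w.1.adicCompletion L))) *ᵥ y) ∈ scaleLattice ((ϖ : (w.1.adicCompletion L)) ^ (d₀ + 1)) v.1) ∧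
        ¬ (∃ y ∈ v.1, y 1 = 0 ∧ ∃ a : (w.1.adicCompletion L), Valued.v a = 1 ∧ Valued.v (((ϖ : (w.1.adicCompletion L)) ^ d₀)⁻¹ * pairing (galAdicCompletionMap (L := L) (IsCMField.complexConj L) hw) ((StdForm.antidiagonal 3).over (w.1.adicCompletion L)) y ((((γ : GL (Fin 3) (w.1.adicCompletion L)) : Matrix (Fin 3) (Fin 3) (w.1.adicCompletion L)) - ((B₀ : Matrix (Fin 2) (Fin 2) (w.1.adicCompletion L)).trace / 2) • (1 : Matrix (Fin 3) (Fin 3) (w.1.adicCompletion L))) *ᵥ y) - c₀ * a ^ 2) < 1)}.ncard = (Nat.card (𝓞 ↥(maximalRealSubfield L) ⧸ v.asIdeal)) + 1 := by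
  have hc1 : IsCMField.complexConj L ≠ 1 := IsCMField.complexConj_ne_one L
  have hσ : ∀ a, (galAdicCompletionMap (L := L) (IsCMField.complexConj L) hw) ((galAdicCompletionMap (L := L) (IsCMField.complexConj L) hw) a) = a := fun a =>
    Liu2021.galAdicCompletionMap_galAdicCompletionMap_self (↥(maximalRealSubfield L)) L (IsCMField.complexConj L)
      (AlgEquiv.ext fun x => IsCMField.complexConj_apply_apply L x) hw a
  have hvσ : ∀ a, Valued.v ((galAdicCompletionMap (L := L) (IsCMField.complexConj L) hw) a) = Valued.v a := fun a => valued_galAdicCompletionMap (L := L) (IsCMField.complexConj L) hw a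
  have h2w : Valued.v (2 : (w.1.adicCompletion L)) = 1 := by
    have h := ((Valuation.integer.integers (ValuativeRel.valuation (w.1.adicCompletion L))).isUnit_iff_valuation_eq_one).1 h2
    exact (v_eq_one_iff_valuation_eq_one _).2 h
  have hϖ0 : (ϖ : (w.1.adicCompletion L)) ≠ 0 := ϖ.ne_zero
  have hϖ1 : Valued.v (ϖ : (w.1.adicCompletion L)) ≤ 1 := by rw [hϖ, ← WithZero.exp_zero]; exact WithZero.exp_le_exp.2 (by norm_num)
  haveI := isPrincipalIdealRing_integer_adicCompletion L v w
  have hH : (!![(0 : (w.1.adicCompletion L)), 1; 1, 0] : Matrix (Fin 2) (Fin 2) (w.1.adicCompletion L)) = placeForm (Matrix.of fun i j : Fin 2 => if i.val + j.val + 1 = 2 then (1 : L) else 0) w.1 := by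
    rw [placeForm_antidiagOne, stdForm_antidiagonal_two_over_eq]
  have hB₀' : B₀ ∈ (unitaryGroupOfForm (galAdicCompletionMap (L := L) (IsCMField.complexConj L) hw) (placeForm (Matrix.of fun i j : Fin 2 => if i.val + j.val + 1 = 2 then (1 : L) else 0) w.1)) := by rw [← hH]; exact hB₀
  set γ₂ : ((cmDatum L 2 (Matrix.of fun i j : Fin 2 => if i.val + j.val + 1 = 2 then (1 : L) else 0)).Local v) := ((localNonsplitEquiv (IsCMField.complexConj L) (Matrix.of fun i j : Fin 2 => if i.val + j.val + 1 = 2 then (1 : L) else 0) (IsCMField.complexConj_ne_one L) w hw)).symm ⟨B₀, hB₀'⟩ with hγ₂def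
  have heγ : (((localNonsplitEquiv (IsCMField.complexConj L) (Matrix.of fun i j : Fin 2 => if i.val + j.val + 1 = 2 then (1 : L) else 0) (IsCMField.complexConj_ne_one L) w hw) γ₂ : ↥(unitaryGroupOfForm (galAdicCompletionMap (L := L) (IsCMField.complexConj L) hw) (placeForm (Matrix.of fun i j : Fin 2 => if i.val + j.val + 1 = 2 then (1 : L) else 0) w.1))) : GL (Fin 2) (w.1.adicCompletion L)) = B₀ := by
    rw [hγ₂def, ContinuousMulEquiv.apply_symm_apply]
  -- TOP-ness: the centred `ϖ^(d₀+1) = ϖ^(2n)`-ball of `B₀`-fixed self-dual lattices is EMPTY (★ part X §1 at `γ₂ := e₂⁻¹B₀`)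
  have htop : {B : Submodule (Valued.integer (w.1.adicCompletion L)) (Fin 2 → (w.1.adicCompletion L)) | IsSelfDualLattice (galAdicCompletionMap (L := L) (IsCMField.complexConj L) hw) (ϖ : (w.1.adicCompletion L)) (!![(0 : (w.1.adicCompletion L)), 1; 1, 0] : Matrix (Fin 2) (Fin 2) (w.1.adicCompletion L)) B ∧ mapGL B₀ B = B ∧
        B.map ((Matrix.toLin' ((B₀ : Matrix (Fin 2) (Fin 2) (w.1.adicCompletion L)) - ((B₀ : Matrix (Fin 2) (Fin 2) (w.1.adicCompletion L)).trace / 2) • (1 : Matrix (Fin 2) (Fin 2) (w.1.adicCompletion L)))).restrictScalars (Valued.integer (w.1.adicCompletion L))) ≤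
          scaleLattice ((ϖ : (w.1.adicCompletion L)) ^ (d₀ + 1)) B} = ∅ := by
    have hFfin := finite_selfDual_fixed_of_even_depth_ramified L v w hw he h2 ϖ hϖ hσϖ γ₂ (by rw [heγ]; exact hirr) (n := n) (by rw [heγ]; exact hN) hn1
    have h0 := ncard_selfDual_fixed_centredBall_top_eq_zero_of_even_depth_ramified L v w hw he h2 ϖ hϖ hσϖ γ₂ (by rw [heγ]; exact hirr) (n := n)
      (by rw [heγ]; exact hN) hn1
    have hempty := (Set.ncard_eq_zero (hFfin.subset fun B hB => ⟨hB.1, hB.2.1⟩)).1 h0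
    rw [heγ, ← hH, ← hd] at hempty
    exact hempty
  rw [ncard_rootRegion_shell_not_class_eq_ncard_two_of_top hσ hvσ hϖ γ B₀ hγ h2w hB₀ hα htop c₀]
  exact two_mul_ncard_selfDual_fixed_lev_centredShell_not_class_eq_of_top_of_mem_unitaryGroupOfForm L v w hw he h2 ϖ hϖ hσϖ B₀ hB₀ hirr hN hn1 hd hα c₀ ε hc₀ hεv hε

end Literature.NumberTheory.Automorphic.UnitaryGroup

end
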